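import Mathlib
import Summits.ValiantsHypothesis.ValiantsHypothesis.Theorems.RigidityForcesSymmetryRankRigidMinimalReprLaplaceFiveSeparatedCaptureTriangle
import Summits.ValiantsHypothesis.ValiantsHypothesis.Theorems.RigidityForcesSymmetryRankRigidMinimalReprLaplaceFiveSeparatedCaptureSpanTools

/-!
# ValiantsHypothesis / RigidityForcesSymmetry — crux `LaplaceOptimalFive` (stmt-ValiantsHypothesis-24813), symmetric capture:
# ★ **THE BINARY LEAF OF THE COMMON-LINE PROFILE** (`U₀₁ = span {u, a}`, `a ∉ U₀₂`, all spans killed by a common `K` of `finrank ≥ 3`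
# ⇒ `finrank W ≤ 5`) and its reading for a flat common line inside a binary net

Brick 3 (part 2) of the `(2,2,2)♭` residue of the K1 lane (val-port-2 g6, 2026-08-29).  In the representation of record
`T_μ = Sym(u ⊗ s) + Sym(a ⊗ t) − G¹ − G²` (two pencils, ✓ `…SeparatedCapturePencilGenerator`), project to `s ∈ ℂ⁵`: on the kernel
`s = 0` every `K`-contraction of `T_μ` vanishes — `a`, the slices of `G¹`, `G²` kill `K`, and the linkage `t_x a − G¹_x ∈ U₀₂`
contracted against `k ∈ K` gives `(t·k) a ∈ U₀₂`, i.e. `t·k = 0` (`a ∉ U₀₂`) — so the contraction map `v ↦ T_μ(·,·,v)` has `K` in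
its kernel, its range (`finrank ≤ 2`) contains the three independent slices of a nonzero square-free tensor
(✓ `three_le_finrank_of_sqfree_slices`): `T_μ = 0`.  Hence `finrank W ≤ 5` (✓ `finrank_map_le_of_ker_le`, ✓ `hub_injective`).
With ✓ `exists_rows_le_two_of_finrank_prolong` (binary net) this closes the FLAT common line `U₀₁, U₀₂, U₁₂ ≤ X`, `finrank X ≤ 3`,
`finrank (prolong X) = 4` at `≤ 5 < 6`.

* ★ `finrank_le_five_of_common_kernel` — the count.
* ★ `captureIneqSym_of_common_line_binary` — flat common line in a binary net (`4 ≤ finrank (prolong X)`): `finrank W ≤ 5`.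

Census of record (val-port-2 g6 `cl6.py`): the residue «all three pairwise prolongations ≥ 2» of the common-line profile had 400
structured samples, 25 of them binary-flat (closed here); the rest (prolongation profiles (2,2,2)…(3,3,4), true capacity ≤ 3) stays OPEN.

Honest framing.  One more leaf of one `(2,2,2)♭` profile; the common-line residue above, every profile with a span of `finrank ≥ 3`
outside the landed cells, `CaptureIneqSym` in general, K1 on `K₃ ⊔ K₂`, `LaplaceOptimalFive` (OPEN · CONTESTED 72/120),
`RankRigidMinimalRepr` and `VP ≠ VNP` are NOT proved here.  No definitions, no `sorry`.
-/

set_option linter.dupNamespace false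
set_option autoImplicit false

namespace Summit.ValiantsHypothesis.ValiantsHypothesis.Theorems.RigidityForcesSymmetryRankRigidMinimalRepr

namespace LaplaceFiveSeparatedCapture

open Finset

/-- ★ **BINARY-TYPE COUNT.**  `U₀₁ = span {u, a}` (`u, a` symmetric, `a ∉ U₀₂`), `U₀₂`, `U₁₂` symmetric, and a space `K ≤ ℂ⁵` of
`finrank ≥ 3` killed by every matrix of `U₀₁ ⊔ U₀₂ ⊔ U₁₂`.  Then every `W` of symmetric zero-diagonal leaf matrices captured by
`L3 U₀₁ U₀₂ U₁₂` has `finrank W ≤ 5`. [folklore] -/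
theorem finrank_le_five_of_common_kernel (u a : Fin 5 → Fin 5 → ℂ) (hu : ∀ p q, u p q = u q p) (ha : ∀ p q, a p q = a q p)
    (U02 U12 W : Submodule ℂ (Fin 5 → Fin 5 → ℂ))
    (h02s : ∀ x ∈ U02, ∀ p q : Fin 5, x p q = x q p) (h12s : ∀ x ∈ U12, ∀ p q : Fin 5, x p q = x q p)
    (haU : a ∉ U02) (K : Submodule ℂ (Fin 5 → ℂ)) (hK : 3 ≤ Module.finrank ℂ K)
    (hkill : ∀ x ∈ Submodule.span ℂ ({u, a} : Set (Fin 5 → Fin 5 → ℂ)) ⊔ U02 ⊔ U12, ∀ k ∈ K, ∀ p : Fin 5, ∑ r, x p r * k r = 0)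
    (hWs : ∀ μ ∈ W, ∀ s t : Fin 5, μ s t = μ t s) (hWd : ∀ μ ∈ W, ∀ s : Fin 5, μ s s = 0)
    (hWc : ∀ μ ∈ W, contractZ μ ∈ L3 (Submodule.span ℂ ({u, a} : Set (Fin 5 → Fin 5 → ℂ))) U02 U12) :
    Module.finrank ℂ W ≤ 5 := by
  classical
  set P : Submodule ℂ (Fin 5 → Fin 5 → ℂ) := Submodule.span ℂ ({u, a} : Set (Fin 5 → Fin 5 → ℂ)) with hPdef
  have huP : u ∈ P := Submodule.subset_span (by simp)
  have haP : a ∈ P := Submodule.subset_span (by simp)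
  have hPs : ∀ x ∈ P, ∀ p q : Fin 5, x p q = x q p := by
    intro x hx p q
    obtain ⟨c, d, rfl⟩ := Submodule.mem_span_pair.mp hx
    simp only [Pi.add_apply, Pi.smul_apply, smul_eq_mul, hu p q, ha p q]
  -- placements
  let symU : (Fin 5 → ℂ) →ₗ[ℂ] (Fin 5 → Fin 5 → Fin 5 → ℂ) :=
    { toFun := fun z p q r => z p * u q r + z q * u p r + z r * u p q
      map_add' := fun z y => by funext p q r; simp only [Pi.add_apply]; ring
      map_smul' := fun c z => by funext p q r; simp only [Pi.smul_apply, smul_eq_mul, RingHom.id_apply]; ring }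
  let symA : (Fin 5 → ℂ) →ₗ[ℂ] (Fin 5 → Fin 5 → Fin 5 → ℂ) :=
    { toFun := fun z p q r => z p * a q r + z q * a p r + z r * a p q
      map_add' := fun z y => by funext p q r; simp only [Pi.add_apply]; ring
      map_smul' := fun c z => by funext p q r; simp only [Pi.smul_apply, smul_eq_mul, RingHom.id_apply]; ring }
  let tensUA : ((Fin 5 → ℂ) × (Fin 5 → ℂ)) →ₗ[ℂ] (Fin 5 → Fin 5 → Fin 5 → ℂ) :=
    { toFun := fun z x q r => z.1 x * u q r + z.2 x * a q r
      map_add' := fun z y => by funext x q r; simp only [Prod.fst_add, Prod.snd_add, Pi.add_apply]; ring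
      map_smul' := fun c z => by
        funext x q r; simp only [Prod.smul_fst, Prod.smul_snd, Pi.smul_apply, smul_eq_mul, RingHom.id_apply]; ring }
  -- representation space `(s, t, G¹, G²)`
  let Xsp := ((Fin 5 → ℂ) × (Fin 5 → ℂ)) × ((Fin 5 → Fin 5 → Fin 5 → ℂ) × (Fin 5 → Fin 5 → Fin 5 → ℂ))
  let πst : Xsp →ₗ[ℂ] ((Fin 5 → ℂ) × (Fin 5 → ℂ)) := LinearMap.fst ℂ _ _
  let πs : Xsp →ₗ[ℂ] (Fin 5 → ℂ) := (LinearMap.fst ℂ _ _).comp πst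
  let πt : Xsp →ₗ[ℂ] (Fin 5 → ℂ) := (LinearMap.snd ℂ _ _).comp πst
  let πG1 : Xsp →ₗ[ℂ] (Fin 5 → Fin 5 → Fin 5 → ℂ) := (LinearMap.fst ℂ _ _).comp (LinearMap.snd ℂ _ _)
  let πG2 : Xsp →ₗ[ℂ] (Fin 5 → Fin 5 → Fin 5 → ℂ) := (LinearMap.snd ℂ _ _).comp (LinearMap.snd ℂ _ _)
  let Φ : Xsp →ₗ[ℂ] (Fin 5 → Fin 5 → Fin 5 → ℂ) := symU.comp πs + symA.comp πt - πG1 - πG2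
  let lamB : Xsp →ₗ[ℂ] (Fin 5 → Fin 5 → Fin 5 → ℂ) := tensUA.comp πst - πG1
  let lamC : Xsp →ₗ[ℂ] (Fin 5 → Fin 5 → Fin 5 → ℂ) := tensUA.comp πst - πG2
  have hΦ : ∀ x : Xsp, ∀ p q r, Φ x p q r = (x.1.1 p * u q r + x.1.1 q * u p r + x.1.1 r * u p q)
      + (x.1.2 p * a q r + x.1.2 q * a p r + x.1.2 r * a p q) - x.2.1 p q r - x.2.2 p q r := fun x p q r => rfl
  have hlamB : ∀ x : Xsp, ∀ y q r, lamB x y q r = x.1.1 y * u q r + x.1.2 y * a q r - x.2.1 y q r := fun x y q r => rfl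
  have hlamC : ∀ x : Xsp, ∀ y q r, lamC x y q r = x.1.1 y * u q r + x.1.2 y * a q r - x.2.2 y q r := fun x y q r => rfl
  have hπs : ∀ x : Xsp, πs x = x.1.1 := fun x => rfl
  have hπG1 : ∀ x : Xsp, πG1 x = x.2.1 := fun x => rfl
  have hπG2 : ∀ x : Xsp, πG2 x = x.2.2 := fun x => rfl
  let U02pi : Submodule ℂ (Fin 5 → Fin 5 → Fin 5 → ℂ) := Submodule.pi Set.univ (fun _ : Fin 5 => U02)
  let U12pi : Submodule ℂ (Fin 5 → Fin 5 → Fin 5 → ℂ) := Submodule.pi Set.univ (fun _ : Fin 5 => U12)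
  let R : Submodule ℂ Xsp := (W.map cZ).comap Φ ⊓ ((prolong (P ⊔ U02)).comap πG1 ⊓ ((prolong (P ⊔ U12)).comap πG2 ⊓
    (U02pi.comap lamB ⊓ U12pi.comap lamC)))
  -- every obligation lies in `Φ(R)`
  have hmem : ∀ μ ∈ W, contractZ μ ∈ R.map Φ := by
    intro μ hμ
    obtain ⟨A, B, C, hA, hB, hC, hT⟩ := L3_finite_form P U02 U12 (hWc μ hμ)
    have hAc : ∀ y, ∃ c d : ℂ, c • u + d • a = A y := fun y => Submodule.mem_span_pair.mp (hA y)
    choose s t hst using hAc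
    have hA' : ∀ y p q, A y p q = s y * u p q + t y * a p q := fun y p q => by
      rw [← hst y]; simp only [Pi.add_apply, Pi.smul_apply, smul_eq_mul]
    have hAs : ∀ y p q, A y p q = A y q p := fun y => hPs _ (hA y)
    let G1 : Fin 5 → Fin 5 → Fin 5 → ℂ := fun x y z => A x y z - B x y z
    let G2 : Fin 5 → Fin 5 → Fin 5 → ℂ := fun x y z => A x y z - C x y z
    have hG1d : ∀ x y z, G1 x y z = A x y z - B x y z := fun _ _ _ => rfl
    have hG2d : ∀ x y z, G2 x y z = A x y z - C x y z := fun _ _ _ => rfl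
    have h1_23 : ∀ x y z, G1 x y z = G1 x z y := fun x y z => by rw [hG1d, hG1d, hAs x y z, h02s _ (hB x) y z]
    have h2_23 : ∀ x y z, G2 x y z = G2 x z y := fun x y z => by rw [hG2d, hG2d, hAs x y z, h12s _ (hC x) y z]
    have h1_13 : ∀ x y z, G1 x y z = G1 z y x := fun x y z => by
      have h := contractZ_swap23 μ y x z
      rw [hT, hT] at h
      have hc := h12s _ (hC y) z x
      rw [hG1d, hG1d]
      linear_combination h - hc
    have h2_13 : ∀ x y z, G2 x y z = G2 z y x := fun x y z => by
      have h : contractZ μ z y x = contractZ μ x y z := by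
        rw [contractZ_swap12 μ y z x, contractZ_swap23 μ y x z, contractZ_swap12 μ x y z]
      rw [hT, hT, hAs x z y, hAs z x y] at h
      have hb := h02s _ (hB y) z x
      rw [hG2d, hG2d]
      linear_combination h - hb
    have h1_12 : ∀ x y z, G1 x y z = G1 y x z := fun x y z => by rw [h1_23 y x z, h1_13 y z x, h1_23 x z y]
    have h2_12 : ∀ x y z, G2 x y z = G2 y x z := fun x y z => by rw [h2_23 y x z, h2_13 y z x, h2_23 x z y]
    have hAx : ∀ x, A x = s x • u + t x • a := fun x => by
      funext p q; rw [hA']; simp only [Pi.add_apply, Pi.smul_apply, smul_eq_mul]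
    have hG1p : G1 ∈ prolong (P ⊔ U02) := by
      refine (mem_prolong_iff _ G1).mpr ⟨h1_12, h1_23, fun x => ?_⟩
      have e : G1 x = A x - B x := by funext y z; rw [hG1d, Pi.sub_apply, Pi.sub_apply]
      rw [e]
      exact Submodule.sub_mem _ (Submodule.mem_sup_left (hA x)) (Submodule.mem_sup_right (hB x))
    have hG2p : G2 ∈ prolong (P ⊔ U12) := by
      refine (mem_prolong_iff _ G2).mpr ⟨h2_12, h2_23, fun x => ?_⟩
      have e : G2 x = A x - C x := by funext y z; rw [hG2d, Pi.sub_apply, Pi.sub_apply]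
      rw [e]
      exact Submodule.sub_mem _ (Submodule.mem_sup_left (hA x)) (Submodule.mem_sup_right (hC x))
    have hrep : Φ ((s, t), (G1, G2)) = contractZ μ := by
      funext p q r
      rw [hΦ, hT p q r]
      show (s p * u q r + s q * u p r + s r * u p q) + (t p * a q r + t q * a p r + t r * a p q) - G1 p q r - G2 p q r
        = A r p q + B q p r + C p q r
      rw [h1_12 p q r, hG1d, hG2d, hA' r p q, hA' q p r, hA' p q r]
      ring
    refine Submodule.mem_map.mpr ⟨((s, t), (G1, G2)), ?_, hrep⟩
    refine Submodule.mem_inf.mpr ⟨?_, Submodule.mem_inf.mpr ⟨?_, Submodule.mem_inf.mpr ⟨?_, Submodule.mem_inf.mpr ⟨?_, ?_⟩⟩⟩⟩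
    · rw [Submodule.mem_comap, hrep]
      exact Submodule.mem_map.mpr ⟨μ, hμ, cZ_apply μ⟩
    · rw [Submodule.mem_comap]; exact hG1p
    · rw [Submodule.mem_comap]; exact hG2p
    · rw [Submodule.mem_comap, Submodule.mem_pi]
      intro y _
      have e : lamB ((s, t), (G1, G2)) y = B y := by
        funext q r
        rw [hlamB]
        show s y * u q r + t y * a q r - G1 y q r = B y q r
        rw [hG1d, hA']; ring
      rw [e]; exact hB y
    · rw [Submodule.mem_comap, Submodule.mem_pi]
      intro y _
      have e : lamC ((s, t), (G1, G2)) y = C y := by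
        funext q r
        rw [hlamC]
        show s y * u q r + t y * a q r - G2 y q r = C y q r
        rw [hG2d, hA']; ring
      rw [e]; exact hC y
  -- the kernel of the projection `s`: every `K`-contraction of the obligation vanishes, hence the obligation is `0`
  have hXk : ∀ x ∈ P ⊔ U02 ⊔ U12, ∀ k ∈ K, ∀ p : Fin 5, ∑ r, x p r * k r = 0 := hkill
  have hker : ∀ x ∈ R, πs x = 0 → Φ x = 0 := by
    intro x hx hs0
    obtain ⟨hxW, hx2⟩ := Submodule.mem_inf.mp hx
    obtain ⟨hxG1, hx3⟩ := Submodule.mem_inf.mp hx2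
    obtain ⟨hxG2, hx4⟩ := Submodule.mem_inf.mp hx3
    obtain ⟨hxB, -⟩ := Submodule.mem_inf.mp hx4
    rw [Submodule.mem_comap, Submodule.mem_pi] at hxB
    rw [Submodule.mem_comap, hπG1] at hxG1
    rw [Submodule.mem_comap, hπG2] at hxG2
    rw [hπs] at hs0
    rw [Submodule.mem_comap] at hxW
    obtain ⟨μ, hμW, hμ⟩ := Submodule.mem_map.mp hxW
    rw [cZ_apply] at hμ
    obtain ⟨h1_12, h1_23, h1sl⟩ := (mem_prolong_iff _ _).mp hxG1
    obtain ⟨h2_12, h2_23, h2sl⟩ := (mem_prolong_iff _ _).mp hxG2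
    have hG1X : ∀ y, x.2.1 y ∈ P ⊔ U02 ⊔ U12 := fun y => Submodule.mem_sup_left (h1sl y)
    have hG2X : ∀ y, x.2.2 y ∈ P ⊔ U02 ⊔ U12 := fun y =>
      (sup_le_sup_left (le_sup_right : U12 ≤ U02 ⊔ U12) P).trans (le_of_eq (sup_assoc P U02 U12).symm) |>
        (fun h => h (h2sl y))
    have haX : a ∈ P ⊔ U02 ⊔ U12 := Submodule.mem_sup_left (Submodule.mem_sup_left haP)
    -- `t · k = 0` for `k ∈ K`
    have htk : ∀ k ∈ K, ∑ y, x.1.2 y * k y = 0 := by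
      intro k hk
      by_contra hne
      -- `Σ_y k_y (t_y a − G¹_y) = (t·k) a` lies in `U₀₂`
      have hsum : (∑ y, k y • lamB x y) ∈ U02 := U02.sum_mem fun y _ => U02.smul_mem _ (hxB y (Set.mem_univ y))
      have e : (∑ y, k y • lamB x y) = (∑ y, x.1.2 y * k y) • a := by
        funext q r
        simp only [Finset.sum_apply, Pi.smul_apply, smul_eq_mul, hlamB, hs0, Pi.zero_apply, zero_mul, zero_add]
        have hg : ∑ y, k y * x.2.1 y q r = 0 := by
          have h := hXk _ (hG1X q) k hk r
          rw [← h]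
          refine Finset.sum_congr rfl fun y _ => ?_
          rw [h1_12 y q r, h1_23 q y r]; ring
        calc ∑ y, k y * (x.1.2 y * a q r - x.2.1 y q r)
            = (∑ y, x.1.2 y * k y) * a q r - ∑ y, k y * x.2.1 y q r := by
              rw [Finset.sum_mul, ← Finset.sum_sub_distrib]
              refine Finset.sum_congr rfl fun y _ => by ring
          _ = (∑ y, x.1.2 y * k y) * a q r := by rw [hg, sub_zero]
      rw [e] at hsum
      have : a ∈ U02 := by
        have h2 := U02.smul_mem (∑ y, x.1.2 y * k y)⁻¹ hsum
        rwa [smul_smul, inv_mul_cancel₀ hne, one_smul] at h2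
      exact haU this
    -- every `K`-contraction of `T_μ = Φ x` vanishes
    have hTk : ∀ k ∈ K, ∀ p q, ∑ r, contractZ μ p q r * k r = 0 := by
      intro k hk p q
      have hak : ∑ r, a q r * k r = 0 := hXk a haX k hk q
      have hak' : ∑ r, a p r * k r = 0 := hXk a haX k hk p
      have hg1 : ∑ r, x.2.1 p q r * k r = 0 := hXk _ (hG1X p) k hk q
      have hg2 : ∑ r, x.2.2 p q r * k r = 0 := hXk _ (hG2X p) k hk q
      have ht := htk k hk
      have e : ∀ r, contractZ μ p q r = x.1.2 p * a q r + x.1.2 q * a p r + x.1.2 r * a p q - x.2.1 p q r - x.2.2 p q r := by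
        intro r
        rw [hμ, hΦ, hs0]
        simp only [Pi.zero_apply, zero_mul, add_zero, zero_add]
      calc ∑ r, contractZ μ p q r * k r
          = x.1.2 p * (∑ r, a q r * k r) + x.1.2 q * (∑ r, a p r * k r) + (∑ r, x.1.2 r * k r) * a p q
              - ∑ r, x.2.1 p q r * k r - ∑ r, x.2.2 p q r * k r := by
            rw [Finset.mul_sum, Finset.mul_sum, Finset.sum_mul, ← Finset.sum_add_distrib, ← Finset.sum_add_distrib,
              ← Finset.sum_sub_distrib, ← Finset.sum_sub_distrib]
            refine Finset.sum_congr rfl fun r _ => ?_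
            rw [e r]; ring
        _ = 0 := by rw [hak, hak', ht, hg1, hg2]; ring
    -- the contraction map kills `K`: range of finrank `≤ 2` containing all slices ⇒ `T_μ = 0`
    let Ψ : (Fin 5 → ℂ) →ₗ[ℂ] (Fin 5 → Fin 5 → ℂ) :=
      { toFun := fun v p q => ∑ r, contractZ μ p q r * v r
        map_add' := fun v v' => by
          funext p q
          simp only [Pi.add_apply, mul_add, Finset.sum_add_distrib]
        map_smul' := fun c v => by
          funext p q
          simp only [Pi.smul_apply, smul_eq_mul, RingHom.id_apply, Finset.mul_sum]
          refine Finset.sum_congr rfl fun r _ => by ring }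
    have hΨ : ∀ v p q, Ψ v p q = ∑ r, contractZ μ p q r * v r := fun v p q => rfl
    have hKle : K ≤ LinearMap.ker Ψ := fun k hk => by
      rw [LinearMap.mem_ker]
      funext p q
      rw [hΨ, hTk k hk p q]
      rfl
    have hrank : Module.finrank ℂ (LinearMap.range Ψ) ≤ 2 := by
      have h := LinearMap.finrank_range_add_finrank_ker Ψ
      rw [Module.finrank_fin_fun] at h
      have := Submodule.finrank_mono hKle
      omega
    have hsl : ∀ y, contractZ μ y ∈ LinearMap.range Ψ := fun y => by
      refine LinearMap.mem_range.mpr ⟨Pi.single y 1, ?_⟩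
      funext p q
      rw [hΨ, Finset.sum_eq_single y (fun r _ hr => by rw [Pi.single_eq_of_ne hr, mul_zero])
        (fun h => absurd (Finset.mem_univ y) h), Pi.single_eq_same, mul_one]
      rw [← contractZ_swap23 μ p q y]
      exact contractZ_swap12 μ y p q
    by_contra hne
    have hT0 : contractZ μ ≠ 0 := by rw [hμ]; exact hne
    have h3 := three_le_finrank_of_sqfree_slices (LinearMap.range Ψ) (contractZ μ)
      (fun p q r => (contractZ_swap12 μ p q r).symm) (fun p q r => (contractZ_swap23 μ p q r).symm)
      (fun p r => contractZ_rep12 μ p r) hT0 hsl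
    omega
  -- counting
  let f : W →ₗ[ℂ] (R.map Φ) := LinearMap.codRestrict (R.map Φ) (cZ.domRestrict W) (fun μ => by
    simpa [cZ_apply] using hmem μ.1 μ.2)
  have hf : Function.Injective f := by
    rw [injective_iff_map_eq_zero]
    intro μ hμ
    have hT : contractZ μ.1 = 0 := by
      have := congrArg Subtype.val hμ
      simpa [f, cZ_apply] using this
    apply Subtype.ext
    refine hub_injective μ.1 (hWs μ.1 μ.2) (hWd μ.1 μ.2) fun p q => ?_
    simp [hT]
  have hW_le := LinearMap.finrank_le_finrank_of_injective hf
  have hle := finrank_map_le_of_ker_le Φ πs R hker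
  have h5 : Module.finrank ℂ (R.map πs) ≤ 5 := by
    have := Submodule.finrank_le (R.map πs)
    rw [Module.finrank_fin_fun] at this
    exact this
  omega

/-- ★ **FLAT COMMON LINE IN A BINARY NET.**  `U₀₁ = span {u, a}`, `U₀₂`, `U₁₂ ≤ X` symmetric, `finrank X ≤ 3`, `a ∉ U₀₂`, and
`4 ≤ finrank (prolong X)` (so `X` is a binary net, ✓ `exists_rows_le_two_of_finrank_prolong`): `finrank W ≤ 5`. [folklore] -/
theorem captureIneqSym_of_common_line_binary (u a : Fin 5 → Fin 5 → ℂ) (hu : ∀ p q, u p q = u q p) (ha : ∀ p q, a p q = a q p)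
    (U02 U12 X W : Submodule ℂ (Fin 5 → Fin 5 → ℂ)) (hXs : ∀ x ∈ X, ∀ p q : Fin 5, x p q = x q p)
    (hX1 : Submodule.span ℂ ({u, a} : Set (Fin 5 → Fin 5 → ℂ)) ≤ X) (hX2 : U02 ≤ X) (hX3 : U12 ≤ X)
    (hX : Module.finrank ℂ X ≤ 3) (hp4 : 4 ≤ Module.finrank ℂ (prolong X)) (haU : a ∉ U02)
    (hWs : ∀ μ ∈ W, ∀ s t : Fin 5, μ s t = μ t s) (hWd : ∀ μ ∈ W, ∀ s : Fin 5, μ s s = 0)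
    (hWc : ∀ μ ∈ W, contractZ μ ∈ L3 (Submodule.span ℂ ({u, a} : Set (Fin 5 → Fin 5 → ℂ))) U02 U12) :
    Module.finrank ℂ W ≤ 5 := by
  classical
  have h02s : ∀ x ∈ U02, ∀ p q : Fin 5, x p q = x q p := fun x hx => hXs x (hX2 hx)
  have h12s : ∀ x ∈ U12, ∀ p q : Fin 5, x p q = x q p := fun x hx => hXs x (hX3 hx)
  obtain ⟨p, hL, hrows⟩ := exists_rows_le_two_of_finrank_prolong X hXs hX hp4
  let Bil : (Fin 5 → ℂ) →ₗ[ℂ] (Fin 5 → ℂ) →ₗ[ℂ] ℂ :=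
    LinearMap.mk₂ ℂ (fun l k : Fin 5 → ℂ => ∑ r, l r * k r)
      (fun l l' k => by simp only [Pi.add_apply, add_mul, Finset.sum_add_distrib])
      (fun c l k => by simp only [Pi.smul_apply, smul_eq_mul, Finset.mul_sum, mul_assoc])
      (fun l k k' => by simp only [Pi.add_apply, mul_add, Finset.sum_add_distrib])
      (fun c l k => by simp only [Pi.smul_apply, smul_eq_mul, Finset.mul_sum, mul_left_comm])
  let dotL : (Fin 5 → ℂ) →ₗ[ℂ] Module.Dual ℂ (rowIm X p) := (Bil.domRestrict (rowIm X p)).flip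
  have hdotL : ∀ (k : Fin 5 → ℂ) (l : rowIm X p), dotL k l = ∑ r, (l : Fin 5 → ℂ) r * k r := fun k l => rfl
  have hK : 3 ≤ Module.finrank ℂ (LinearMap.ker dotL) := by
    have h := LinearMap.finrank_range_add_finrank_ker dotL
    rw [Module.finrank_fin_fun] at h
    have e : Module.finrank ℂ (Module.Dual ℂ (rowIm X p)) = Module.finrank ℂ (rowIm X p) := Subspace.dual_finrank_eq
    have hr : Module.finrank ℂ (LinearMap.range dotL) ≤ Module.finrank ℂ (Module.Dual ℂ (rowIm X p)) :=
      Submodule.finrank_le _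
    omega
  have hkill : ∀ x ∈ Submodule.span ℂ ({u, a} : Set (Fin 5 → Fin 5 → ℂ)) ⊔ U02 ⊔ U12, ∀ k ∈ LinearMap.ker dotL,
      ∀ q : Fin 5, ∑ r, x q r * k r = 0 := by
    intro x hx k hk q
    have hxX : x ∈ X := (sup_le (sup_le hX1 hX2) hX3) hx
    have hk0 := LinearMap.mem_ker.mp hk
    have := congrArg (fun φ : Module.Dual ℂ (rowIm X p) => φ ⟨x q, hrows x hxX q⟩) hk0
    simpa [hdotL] using this
  exact finrank_le_five_of_common_kernel u a hu ha U02 U12 W h02s h12s haU (LinearMap.ker dotL) hK hkill hWs hWd hWc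

end LaplaceFiveSeparatedCapture

end Summit.ValiantsHypothesis.ValiantsHypothesis.Theorems.RigidityForcesSymmetryRankRigidMinimalRepr
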